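import Summits.AnomalousDissipation.AnomalousDissipation.Theorems.ScalarAnomalySteadySourceFormal.Negative.CellTotal
import Summits.AnomalousDissipation.AnomalousDissipation.Theorems.ScalarAnomalySteadySourceFormal.Negative.ShearNoGo

/-!
# Negative knowledge for the crux `ScalarAnomalySteadySourceFormal` (stmt-AnomalousDissipation-0448), VIII-d:
# NO-GO — uniformly band-limited stirring (any geometry) carries no scalar anomaly

Certified copy of §10.4 of the cdisprove work file, the assembly.  **Theorem**
(`bandLimited_not_anomalous`): let the velocity fields of a family be real trigonometric polynomials
`u_j(t) = realTrigPoly S (c_j t)` on ONE finite set of modes `S ⊆ {|k 0| ≤ R, |k 1| ≤ R}` — cellular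
flows, Galilean-swept cellular states, every fixed Galerkin truncation of a planar Navier–Stokes
flow with bounded coefficients — continuous coefficient paths bounded by `M` uniformly in `j`,
transversal (`k · c_j(t,k) = 0`); ONE smooth mean-zero source `h`, `ν_j → 0`, ARBITRARY `L²` data,
ARBITRARY global weak solutions of the crux's forced class.  If `⟨‖θ_j‖²⟩ ≤ E` for all `j` then
`inf_j ⟨ν_j‖∇θ_j‖²⟩ = 0`: no anomaly.

So a witness of the crux needs stirring with `j`-UNBOUNDED SPECTRAL REACH (the Fourier support of
`v_j` cannot stay in a fixed ball with bounded amplitudes): the Batchelor regime is not anomalous.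
Mechanism: Batchelor's bookkeeping made rigorous for weak solutions — the flux through `|p|_∞ = K`
is `≤ 8π #S M (K+R) · (energy in the square layer at K)` (`Negative.CellFlux`), the layers are
`2R`-fold overlapping, so a HARMONIC pigeonhole over `K ∈ [K₀, K₁]` (`exists_weighted_slayer_small`)
gains the divergent factor `∑_{K₀ ≤ K ≤ K₁} 1/(K+R)` (`harmonic_window_unbounded`), i.e. a
logarithm of `K₁ ~ ν^{-1/2}`; outer truncations are removed against the spectral tail
(`Negative.CellTotal`), the variance is honest by Poincaré (`Negative.ShearHonest`).
Corollaries: `not_cruxBandLimited`, `not_anomalous_of_isCandidate_bandLimited`.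

Supports stmt-AnomalousDissipation-0448.
-/

set_option linter.dupNamespace false

noncomputable section

open scoped BigOperators Topology ENNReal NNReal InnerProductSpace ContDiff
open Filter Set Function MeasureTheory UnitAddTorus Complex

namespace Summit.AnomalousDissipation.AnomalousDissipation.Theorems.ScalarAnomalySteadySourceFormal.Negative

open Literature.Analysis
open Literature.Analysis.FunctionSpaces Literature.Analysis.FunctionSpaces.Torus
open Literature.Analysis.FluidPDE Literature.Analysis.FluidPDE.Torus

/-- The frequency lattice `ℤ²` (local notation). -/
local notation "ℤ²" => Fin 2 → ℤ

section Harmonic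

/-- **Weighted pigeonhole**: if `∑_{i∈I} a i ≤ B` with `a ≥ 0` and positive weights `w`, some `i`
has `w i · a i ≤ B / ∑_{i∈I} (w i)⁻¹`. [folklore] -/
theorem exists_weighted_le {ι : Type*} {I : Finset ι} (hI : I.Nonempty) {a w : ι → ℝ} {B : ℝ}
    (hw : ∀ i ∈ I, 0 < w i) (hsum : ∑ i ∈ I, a i ≤ B) :
    ∃ i ∈ I, w i * a i ≤ B / ∑ i ∈ I, (w i)⁻¹ := by
  have hH : 0 < ∑ i ∈ I, (w i)⁻¹ := Finset.sum_pos (fun i hi => inv_pos.2 (hw i hi)) hI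
  by_contra hcon
  push Not at hcon
  have hlt : ∀ i ∈ I, B / (∑ i ∈ I, (w i)⁻¹) * (w i)⁻¹ < a i := by
    intro i hi
    rw [← div_eq_mul_inv, div_lt_iff₀ (hw i hi), mul_comm]
    exact hcon i hi
  have := Finset.sum_lt_sum_of_nonempty hI hlt
  rw [← Finset.mul_sum, div_mul_cancel₀ _ hH.ne'] at this
  linarith

/-- **The harmonic window diverges**: for `c ≥ 1` and every bound `H₀` there is `n ≥ 1` with
`H₀ ≤ ∑_{x<n} 1/(c + x)`. [folklore] -/
theorem harmonic_window_unbounded {c : ℕ} (hc : 1 ≤ c) (H₀ : ℝ) :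
    ∃ n : ℕ, 1 ≤ n ∧ H₀ ≤ ∑ x ∈ Finset.range n, ((c : ℝ) + x)⁻¹ := by
  set P : ℕ → ℝ := fun n => ∑ i ∈ Finset.range n, (1 / ((i : ℝ) + 1)) with hP
  have htend : Tendsto P atTop atTop := Real.tendsto_sum_range_one_div_nat_succ_atTop
  have hwin : ∀ n, ∑ x ∈ Finset.range n, ((c : ℝ) + x)⁻¹ = P (c - 1 + n) - P (c - 1) := by
    intro n
    simp only [hP]
    rw [Finset.sum_range_add, add_sub_cancel_left]
    refine Finset.sum_congr rfl fun x _ => ?_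
    rw [one_div]
    congr 1
    push_cast [Nat.cast_sub hc]
    ring
  have h2 : Tendsto (fun n : ℕ => P (c - 1 + n)) atTop atTop :=
    htend.comp ((tendsto_add_atTop_nat (c - 1)).congr fun n => add_comm n (c - 1))
  obtain ⟨n, hn1, hn2⟩ := ((eventually_ge_atTop 1).and (h2.eventually (eventually_ge_atTop (H₀ + P (c - 1))))).exists
  exact ⟨n, hn1, by rw [hwin]; linarith⟩

end Harmonic

section CellNoGo

variable {S : Finset ℤ²} {R : ℕ} {M : ℝ} {h : UnitAddTorus (Fin 2) → ℝ}

/-- The tail mass is monotone in the square box size. [folklore] -/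
theorem sourceTailMass_mono_sq (hh : MemLp h 2 volume) {K K' : ℤ} (hK : K ≤ K') :
    sourceTailMass K' K' h ≤ sourceTailMass K K h := by
  classical
  unfold sourceTailMass
  refine Real.sqrt_le_sqrt ?_
  have hsumm : ∀ L : ℤ, Summable fun p : ℤ² => if p ∈ box L L then (0 : ℝ) else ‖mFourierCoeff (fun x => (h x : ℂ)) p‖ ^ 2 := by
    intro L
    refine Summable.of_nonneg_of_le (fun p => by split_ifs <;> positivity) (fun p => ?_)
      (FunctionSpaces.Torus.hasSum_sq_norm_mFourierCoeff_ofReal hh).summable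
    split_ifs
    exacts [sq_nonneg _, le_rfl]
  refine Summable.tsum_le_tsum (fun p => ?_) (hsumm K') (hsumm K)
  by_cases hp : p ∈ box K K
  · have hp' : p ∈ box K' K' := by
      rw [mem_box] at hp ⊢; exact ⟨hp.1.trans hK, hp.2.trans hK⟩
    rw [if_pos hp, if_pos hp']
  · rw [if_neg hp]
    split_ifs
    exacts [sq_nonneg _, le_rfl]

/-- `K₀ + range n = Ico K₀ (K₀ + n)` in `ℤ`. [folklore] -/
theorem image_natCast_add_range (a : ℕ) (n : ℕ) :
    (Finset.range n).image (fun x : ℕ => (a : ℤ) + x) = Finset.Ico (a : ℤ) ((a : ℤ) + n) := by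
  ext K
  simp only [Finset.mem_image, Finset.mem_range, Finset.mem_Ico]
  constructor
  · rintro ⟨x, hx, rfl⟩
    constructor <;> omega
  · rintro ⟨h1, h2⟩
    refine ⟨(K - a).toNat, ?_, ?_⟩ <;> omega

/-- **Harmonic inner pigeonhole**: among the square layers `K = K₀ + x`, `x < n`, one has
`(K + R) ∫ slayerSum_K ≤ 2R ∫‖θ‖² / ∑_{x<n} (K₀+R+x)⁻¹`. [folklore] -/
theorem exists_weighted_slayer_small {ν : ℝ} {u : ℝ → UnitAddTorus (Fin 2) → EuclideanSpace ℝ (Fin 2)}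
    {θ₀ : UnitAddTorus (Fin 2) → ℝ} {θ : ℝ → UnitAddTorus (Fin 2) → ℝ}
    (hw : IsWeakScalarTransportForced ν u (fun _ => h) θ₀ θ) {T : ℝ} (hT : 0 < T) (K₀ : ℕ) (hKR : 1 ≤ K₀ + R)
    {n : ℕ} (hn : 1 ≤ n) :
    ∃ x ∈ Finset.range n, ((K₀ : ℝ) + x + R) * ∫ t in Ioo 0 T, slayerSum ((K₀ : ℤ) + x - R) ((K₀ : ℤ) + x + R) (modes θ t) ≤
      2 * R * (∫ t in Ioo 0 T, scalarL2Sq (θ t)) / ∑ x ∈ Finset.range n, ((K₀ : ℝ) + R + x)⁻¹ := by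
  classical
  have hwT := hw T hT
  have hint : ∀ K : ℤ, IntegrableOn (fun t => slayerSum (K - R) (K + R) (modes θ t)) (Ioo 0 T) volume := by
    intro K
    simpa [slayerSum] using forced_integrableOn_sum_sq_modes hwT (slayer (K - R) (K + R)) (fun _ => 1)
  -- total over the window
  have hsum : ∑ x ∈ Finset.range n, ∫ t in Ioo 0 T, slayerSum ((K₀ : ℤ) + x - R) ((K₀ : ℤ) + x + R) (modes θ t) ≤
      2 * R * ∫ t in Ioo 0 T, scalarL2Sq (θ t) := by
    have e : ∑ x ∈ Finset.range n, ∫ t in Ioo 0 T, slayerSum ((K₀ : ℤ) + x - R) ((K₀ : ℤ) + x + R) (modes θ t) =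
        ∑ K ∈ Finset.Ico (K₀ : ℤ) ((K₀ : ℤ) + n), ∫ t in Ioo 0 T, slayerSum (K - R) (K + R) (modes θ t) := by
      rw [← image_natCast_add_range, Finset.sum_image fun x _ y _ hxy => by simpa using hxy]
    rw [e, ← integral_finsetSum _ fun K _ => hint K, ← integral_const_mul]
    refine integral_mono_ae (integrable_finsetSum _ fun K _ => hint K) ((forced_integrableOn_scalarL2Sq hwT).const_mul _) ?_
    filter_upwards [forced_ae_sum_sq_modes_le hwT (slayer ((K₀ : ℤ) - R) ((K₀ : ℤ) + n + R))] with t ht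
    calc ∑ K ∈ Finset.Ico (K₀ : ℤ) ((K₀ : ℤ) + n), slayerSum (K - R) (K + R) (modes θ t)
        ≤ 2 * R * ∑ p ∈ slayer ((K₀ : ℤ) - R) ((K₀ : ℤ) + n + R), ‖modes θ t p‖ ^ 2 := sum_Ico_slayerSum_le R (K₀ : ℤ) n (modes θ t)
      _ ≤ 2 * R * scalarL2Sq (θ t) := by gcongr
  have hne : (Finset.range n).Nonempty := Finset.nonempty_range_iff.2 (by omega)
  have hKR' : (1 : ℝ) ≤ K₀ + R := by exact_mod_cast hKR
  obtain ⟨x, hx, hle⟩ := exists_weighted_le hne (w := fun x : ℕ => (K₀ : ℝ) + x + R)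
    (fun x _ => by have h0 : (0:ℝ) ≤ x := x.cast_nonneg
                   linarith) hsum
  refine ⟨x, hx, hle.trans (le_of_eq ?_)⟩
  congr 1
  exact Finset.sum_congr rfl fun y _ => by ring_nf

/-- **Per-`T` estimate of the dissipation MEAN** under general band-limited stirring, with the
harmonic inner pigeonhole performed: for `T > 0`, `K₀ + R ≥ 1`, `n ≥ 1` and
`H = ∑_{x<n} (K₀+R+x)⁻¹`,
`⟨ν‖∇θ‖²⟩_T ≤ ‖θ₀‖²/(2T) + (8π²ν(K₀+n)² + 8πR·#S·M/H + η₀/2)·⟨‖θ‖²⟩_T + η₀/2`, `η₀ = η_out(K₀,K₀)`. [folklore] -/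
theorem cell_timeMean_diss_le {ν : ℝ} (hν : 0 < ν) {c : ℝ → ℤ² → EuclideanSpace ℂ (Fin 2)}
    {u : ℝ → UnitAddTorus (Fin 2) → EuclideanSpace ℝ (Fin 2)} {θ₀ : UnitAddTorus (Fin 2) → ℝ}
    {θ : ℝ → UnitAddTorus (Fin 2) → ℝ} (hw : IsWeakScalarTransportForced ν u (fun _ => h) θ₀ θ)
    (hu : ∀ s, u s = realTrigPoly S (c s)) (hh : MemLp h 2 volume) (hθ₀ : MemLp θ₀ 2 volume)
    (hc : ∀ k, Continuous fun s => c s k) (hM : ∀ s k, ‖c s k‖ ≤ M) (hM0 : 0 ≤ M)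
    (htrans : ∀ s, ∀ k ∈ S, zdot k (c s k) = 0) (hS : ∀ k ∈ S, |k 0| ≤ R ∧ |k 1| ≤ R)
    (K₀ : ℕ) (hKR : 1 ≤ K₀ + R) {n : ℕ} (hn : 1 ≤ n) {T : ℝ} (hT : 0 < T) :
    timeMean (fun t => ν * (eScalarGradNormSq (θ t)).toReal) T ≤
      scalarL2Sq θ₀ / (2 * T) +
        (8 * Real.pi ^ 2 * ν * ((K₀ : ℝ) + n) ^ 2 + 8 * Real.pi * R * S.card * M / (∑ x ∈ Finset.range n, ((K₀ : ℝ) + R + x)⁻¹) +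
          sourceTailMass K₀ K₀ h / 2) * timeMean (fun t => scalarL2Sq (θ t)) T +
        sourceTailMass K₀ K₀ h / 2 := by
  have hwT := hw T hT
  have hKR1 : (1 : ℝ) ≤ K₀ + R := by exact_mod_cast hKR
  have hH0 : 0 < ∑ x ∈ Finset.range n, ((K₀ : ℝ) + R + x)⁻¹ := Finset.sum_pos (fun x _ => by
    have h0 : (0:ℝ) ≤ x := x.cast_nonneg
    exact inv_pos.2 (by linarith)) (Finset.nonempty_range_iff.2 (by omega))
  -- harmonic pigeonhole
  obtain ⟨x, hx, hxle⟩ := exists_weighted_slayer_small hw hT K₀ hKR hn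
  rw [Finset.mem_range] at hx
  obtain ⟨K, hKdef⟩ : ∃ K : ℤ, K = (K₀ : ℤ) + x := ⟨_, rfl⟩
  rw [← hKdef] at hxle
  have hK0 : (0 : ℤ) ≤ K := by rw [hKdef]; positivity
  have hK0r : (0 : ℝ) ≤ K := by exact_mod_cast hK0
  have hKR' : ((K : ℝ) + R) = (K₀ : ℝ) + x + R := by rw [hKdef]; push_cast; ring
  -- per-T inequality at K, made real
  have hper := cell_perT_dissipation_le hw hν.le hu hh hθ₀ hc hM hM0 htrans hS hK0 hT
  have hV0 : 0 ≤ ∫ t in Ioo 0 T, scalarL2Sq (θ t) := setIntegral_nonneg measurableSet_Ioo fun _ _ => scalarL2Sq_nonneg _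
  have hG0 : 0 ≤ ∫ t in Ioo 0 T, slayerSum (K - R) (K + R) (modes θ t) :=
    setIntegral_nonneg measurableSet_Ioo fun _ _ => slayerSum_nonneg _ _ _
  have hW0 : 0 ≤ ∫ t in Ioo 0 T, Real.sqrt (scalarL2Sq (θ t)) := setIntegral_nonneg measurableSet_Ioo fun _ _ => Real.sqrt_nonneg _
  have hB0 : 0 ≤ scalarL2Sq θ₀ + 16 * Real.pi ^ 2 * ν * K ^ 2 * (∫ t in Ioo 0 T, scalarL2Sq (θ t)) +
      8 * Real.pi * S.card * M * (K + R) * (∫ t in Ioo 0 T, slayerSum (K - R) (K + R) (modes θ t)) +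
      2 * sourceTailMass K K h * ∫ t in Ioo 0 T, Real.sqrt (scalarL2Sq (θ t)) := by
    have := scalarL2Sq_nonneg θ₀; have := sourceTailMass_nonneg K K h; have := Real.pi_pos
    positivity
  have hIfin : (∫⁻ t in Ioo 0 T, eScalarGradNormSq (θ t)) ≠ ⊤ := by
    intro htop
    rw [htop, ENNReal.mul_top (by simpa using hν)] at hper
    exact ENNReal.ofReal_ne_top (top_le_iff.1 hper)
  have hreal := ENNReal.toReal_le_of_le_ofReal hB0 hper
  rw [ENNReal.toReal_mul, ENNReal.toReal_ofReal (by positivity)] at hreal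
  -- abbreviations (introduced only now, so that they are substituted into the facts above)
  set V : ℝ := ∫ t in Ioo 0 T, scalarL2Sq (θ t) with hV
  set η₀ := sourceTailMass K₀ K₀ h with hη₀
  have hη₀0 : 0 ≤ η₀ := sourceTailMass_nonneg _ _ _
  set H : ℝ := ∑ x ∈ Finset.range n, ((K₀ : ℝ) + R + x)⁻¹ with hH
  set I : ℝ≥0∞ := ∫⁻ t in Ioo 0 T, eScalarGradNormSq (θ t) with hI
  set W : ℝ := ∫ t in Ioo 0 T, Real.sqrt (scalarL2Sq (θ t)) with hW
  set G : ℝ := ∫ t in Ioo 0 T, slayerSum (K - R) (K + R) (modes θ t) with hG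
  have hKR0 : (0 : ℝ) ≤ (K : ℝ) + R := by positivity
  -- pieces
  have hW' : W ≤ (T + V) / 2 := by
    have hi1 : IntegrableOn (fun _ : ℝ => (1 : ℝ)) (Ioo 0 T) volume := integrableOn_const (hs := measure_Ioo_lt_top.ne)
    have h1 : ∫ t in Ioo 0 T, Real.sqrt (scalarL2Sq (θ t)) ≤ ∫ t in Ioo 0 T, (1 + scalarL2Sq (θ t)) / 2 := by
      refine integral_mono_ae (forced_integrableOn_sqrt_scalarL2Sq hwT)
        ((hi1.add (forced_integrableOn_scalarL2Sq hwT)).div_const _) (Eventually.of_forall fun t => ?_)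
      have h0 := scalarL2Sq_nonneg (θ t)
      nlinarith [Real.sq_sqrt h0, sq_nonneg (Real.sqrt (scalarL2Sq (θ t)) - 1), Real.sqrt_nonneg (scalarL2Sq (θ t))]
    rw [integral_div, integral_add hi1 (forced_integrableOn_scalarL2Sq hwT),
      setIntegral_const, Real.volume_real_Ioo_of_le hT.le, sub_zero, smul_eq_mul, mul_one] at h1
    exact h1
  have hxn : K₀ + x ≤ K₀ + n := by omega
  have hη : sourceTailMass K K h ≤ η₀ := sourceTailMass_mono_sq hh (by rw [hKdef]; omega)
  have hK2 : (K : ℝ) ^ 2 ≤ ((K₀ : ℝ) + n) ^ 2 := by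
    have h1 : (K : ℝ) < (K₀ : ℝ) + n := by rw [hKdef]; push_cast; exact_mod_cast (by omega : K₀ + x < K₀ + n)
    have h2 : (0 : ℝ) ≤ K := by exact_mod_cast hK0
    nlinarith
  have hGw : ((K : ℝ) + R) * G ≤ 2 * R * V / H := by rw [hKR']; exact hxle
  have hπ := Real.pi_pos
  -- B ≤ B₂ (linear bookkeeping)
  have s1 : 8 * Real.pi * S.card * M * (K + R) * G ≤ 8 * Real.pi * S.card * M * (2 * R * V / H) := by
    have : 8 * Real.pi * S.card * M * (K + R) * G = (8 * Real.pi * S.card * M) * ((K + R) * G) := by ring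
    rw [this]
    exact mul_le_mul_of_nonneg_left hGw (by positivity)
  have s2 : 16 * Real.pi ^ 2 * ν * (K : ℝ) ^ 2 * V ≤ 16 * Real.pi ^ 2 * ν * ((K₀ : ℝ) + n) ^ 2 * V := by gcongr
  have s3 : 2 * sourceTailMass K K h * W ≤ 2 * η₀ * ((T + V) / 2) :=
    mul_le_mul (by linarith) hW' hW0 (by positivity)
  have hB2 : 2 * ν * I.toReal ≤ scalarL2Sq θ₀ + 16 * Real.pi ^ 2 * ν * ((K₀ : ℝ) + n) ^ 2 * V +
      8 * Real.pi * S.card * M * (2 * R * V / H) + η₀ * (T + V) := by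
    linarith [hreal, s1, s2, s3]
  -- time means
  have htm : timeMean (fun t => ν * (eScalarGradNormSq (θ t)).toReal) T = T⁻¹ * (ν * I.toReal) :=
    timeMean_diss_eq hw hT hIfin
  have htmV : timeMean (fun t => scalarL2Sq (θ t)) T = T⁻¹ * V := by
    rw [timeMean, intervalIntegral.integral_of_le hT.le, integral_Ioc_eq_integral_Ioo]
  rw [htm, htmV]
  have hTi : 0 < T⁻¹ := inv_pos.2 hT
  have e2 : T⁻¹ * ((scalarL2Sq θ₀ + 16 * Real.pi ^ 2 * ν * ((K₀ : ℝ) + n) ^ 2 * V +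
      8 * Real.pi * S.card * M * (2 * R * V / H) + η₀ * (T + V)) / 2) =
      scalarL2Sq θ₀ / (2 * T) +
        (8 * Real.pi ^ 2 * ν * ((K₀ : ℝ) + n) ^ 2 + 8 * Real.pi * R * S.card * M / H + η₀ / 2) * (T⁻¹ * V) + η₀ / 2 := by
    field_simp
    ring
  calc T⁻¹ * (ν * I.toReal) ≤ T⁻¹ * ((scalarL2Sq θ₀ + 16 * Real.pi ^ 2 * ν * ((K₀ : ℝ) + n) ^ 2 * V +
      8 * Real.pi * S.card * M * (2 * R * V / H) + η₀ * (T + V)) / 2) :=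
        mul_le_mul_of_nonneg_left (by linarith) hTi.le
    _ = _ := e2

/-- **NO-GO THEOREM (uniformly band-limited stirring).**  See the file docstring. [folklore] -/
theorem bandLimited_not_anomalous (hh : IsSmooth h) (hmean : HasZeroMean h)
    (hS : ∀ k ∈ S, |k 0| ≤ R ∧ |k 1| ≤ R) (hM0 : 0 ≤ M)
    {νs : ℕ → ℝ} (hν : ∀ j, 0 < νs j) (hν0 : Tendsto νs atTop (nhds 0))
    {cs : ℕ → ℝ → ℤ² → EuclideanSpace ℂ (Fin 2)} (hc : ∀ j k, Continuous fun s => cs j s k)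
    (hM : ∀ j s k, ‖cs j s k‖ ≤ M) (htrans : ∀ j s, ∀ k ∈ S, zdot k (cs j s k) = 0)
    {us : ℕ → ℝ → UnitAddTorus (Fin 2) → EuclideanSpace ℝ (Fin 2)} (hu : ∀ j s, us j s = realTrigPoly S (cs j s))
    {θ₀s : ℕ → UnitAddTorus (Fin 2) → ℝ} (hθ₀ : ∀ j, MemLp (θ₀s j) 2 volume)
    {θs : ℕ → ℝ → UnitAddTorus (Fin 2) → ℝ}
    (hweak : ∀ j, IsWeakScalarTransportForced (νs j) (us j) (fun _ => h) (θ₀s j) (θs j))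
    {E : ℝ} (hV : ∀ j, longTimeAvgSup (fun t => scalarL2Sq (θs j t)) ≤ E) :
    ¬ ∃ ε : ℝ, 0 < ε ∧ ∀ j, ε ≤ longTimeAvgSup (fun t => νs j * (eScalarGradNormSq (θs j t)).toReal) := by
  rintro ⟨ε, hε, hfl⟩
  have hh2 : MemLp h 2 volume := hh.memLp 2
  have hhi : Integrable h volume := hh.integrable
  set E' : ℝ := max E 0 + 1 with hE'
  have hE'1 : 1 ≤ E' := by rw [hE']; have := le_max_right E 0; linarith
  have hE'0 : 0 < E' := by linarith
  have hπ := Real.pi_pos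
  -- (1) the tail cut-off `K₀ = max L 1`
  obtain ⟨L, hL⟩ := sourceTailMass_small hh2 (η := ε / (4 * (1 + E'))) (by positivity)
  set K₀ : ℕ := max L 1 with hK₀
  have hKR : 1 ≤ K₀ + R := by omega
  set η₀ := sourceTailMass K₀ K₀ h with hη₀
  have hη₀0 : 0 ≤ η₀ := sourceTailMass_nonneg _ _ _
  have hη₀le : η₀ ≤ ε / (4 * (1 + E')) :=
    (sourceTailMass_mono_sq hh2 (by rw [hK₀]; exact_mod_cast le_max_left L 1)).trans hL
  -- (2) the harmonic window `n`
  have hKR1 : (1 : ℝ) ≤ K₀ + R := by exact_mod_cast hKR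
  obtain ⟨n, hn1, hn⟩ := harmonic_window_unbounded (c := K₀ + R) hKR (8 * (8 * Real.pi * R * S.card * M * E') / ε)
  have hn' : 8 * (8 * Real.pi * R * S.card * M * E') / ε ≤ ∑ x ∈ Finset.range n, ((K₀ : ℝ) + R + x)⁻¹ := by
    refine hn.trans (le_of_eq (Finset.sum_congr rfl fun x _ => ?_))
    push_cast; rfl
  have hHpos : 0 < ∑ x ∈ Finset.range n, ((K₀ : ℝ) + R + x)⁻¹ :=
    Finset.sum_pos (fun x _ => by
      have h0 : (0:ℝ) ≤ x := x.cast_nonneg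
      exact inv_pos.2 (by linarith)) (Finset.nonempty_range_iff.2 (by omega))
  have hAH : 8 * Real.pi * R * S.card * M * E' / (∑ x ∈ Finset.range n, ((K₀ : ℝ) + R + x)⁻¹) ≤ ε / 8 := by
    rw [div_le_iff₀ hHpos]
    rw [div_le_iff₀ hε] at hn'
    linarith
  -- (3) the index `j`: `ν_j` small
  have hBc0 : 0 < 8 * Real.pi ^ 2 * ((K₀ : ℝ) + n) ^ 2 * E' := by positivity
  obtain ⟨j, hj⟩ := ((tendsto_order.1 hν0).2 (ε / 8 / (8 * Real.pi ^ 2 * ((K₀ : ℝ) + n) ^ 2 * E')) (by positivity)).exists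
  set ν := νs j with hνdef
  have hνpos : 0 < ν := hν j
  have hνB : 8 * Real.pi ^ 2 * ν * ((K₀ : ℝ) + n) ^ 2 * E' ≤ ε / 8 := by
    have : ν < ε / 8 / (8 * Real.pi ^ 2 * ((K₀ : ℝ) + n) ^ 2 * E') := hj
    rw [lt_div_iff₀ hBc0] at this
    have e : 8 * Real.pi ^ 2 * ν * ((K₀ : ℝ) + n) ^ 2 * E' = ν * (8 * Real.pi ^ 2 * ((K₀ : ℝ) + n) ^ 2 * E') := by ring
    rw [e]
    exact this.le
  -- the total coefficient bound (independent of `T`)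
  have hcoef : (8 * Real.pi ^ 2 * ν * ((K₀ : ℝ) + n) ^ 2 +
      8 * Real.pi * R * S.card * M / (∑ x ∈ Finset.range n, ((K₀ : ℝ) + R + x)⁻¹) + η₀ / 2) * E' + η₀ / 2 ≤ 3 * ε / 8 := by
    have h4 : η₀ / 2 * E' + η₀ / 2 ≤ ε / 8 := by
      calc η₀ / 2 * E' + η₀ / 2 = η₀ * ((1 + E') / 2) := by ring
        _ ≤ ε / (4 * (1 + E')) * ((1 + E') / 2) := by gcongr
        _ = ε / 8 := by field_simp; ring
    have h3 : 8 * Real.pi * R * S.card * M / (∑ x ∈ Finset.range n, ((K₀ : ℝ) + R + x)⁻¹) * E' ≤ ε / 8 := by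
      rw [div_mul_eq_mul_div]; exact hAH
    have e : (8 * Real.pi ^ 2 * ν * ((K₀ : ℝ) + n) ^ 2 +
        8 * Real.pi * R * S.card * M / (∑ x ∈ Finset.range n, ((K₀ : ℝ) + R + x)⁻¹) + η₀ / 2) * E' + η₀ / 2 =
        8 * Real.pi ^ 2 * ν * ((K₀ : ℝ) + n) ^ 2 * E' +
          8 * Real.pi * R * S.card * M / (∑ x ∈ Finset.range n, ((K₀ : ℝ) + R + x)⁻¹) * E' + (η₀ / 2 * E' + η₀ / 2) := by
      ring
    rw [e]
    linarith [h3, h4, hνB]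
  have hcoef0 : 0 ≤ 8 * Real.pi ^ 2 * ν * ((K₀ : ℝ) + n) ^ 2 +
      8 * Real.pi * R * S.card * M / (∑ x ∈ Finset.range n, ((K₀ : ℝ) + R + x)⁻¹) + η₀ / 2 := by positivity
  -- (4) honesty of the variance of `θ_j`
  have hw := hweak j
  have hfin : ∀ T, 0 < T → ∫⁻ t in Ioo 0 T, eScalarGradNormSq (θs j t) ≠ ⊤ := by
    intro T hT htop
    have hper := cell_perT_dissipation_le hw hνpos.le (hu j) hh2 (hθ₀ j) (hc j) (hM j) hM0 (htrans j) hS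
      (K := 0) le_rfl hT
    rw [htop, ENNReal.mul_top (by simpa using hνpos)] at hper
    exact ENNReal.ofReal_ne_top (top_le_iff.1 hper)
  have hδ : 0 < E' - E := by rw [hE']; have := le_max_left E 0; linarith
  have hhon := honest_variance hw hνpos hhi hmean ((hθ₀ j).integrable one_le_two) hfin hε (hfl j) (hV j) hδ
  rw [show E + (E' - E) = E' by ring] at hhon
  -- (5) eventually the dissipation mean is ≤ ε/2
  have hev : ∀ᶠ T in atTop, timeMean (fun t => ν * (eScalarGradNormSq (θs j t)).toReal) T ≤ ε / 2 := by
    filter_upwards [hhon, eventually_gt_atTop (0 : ℝ), eventually_ge_atTop (4 * scalarL2Sq (θ₀s j) / ε)]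
      with T hVT hT0 hTθ
    have hest := cell_timeMean_diss_le hνpos hw (hu j) hh2 (hθ₀ j) (hc j) (hM j) hM0 (htrans j) hS K₀ hKR hn1 hT0
    have hVT0 : 0 ≤ timeMean (fun t => scalarL2Sq (θs j t)) T := timeMean_nonneg (fun t => scalarL2Sq_nonneg _) hT0.le
    have h1 : scalarL2Sq (θ₀s j) / (2 * T) ≤ ε / 8 := by
      rw [div_le_iff₀ (by positivity)]
      have hTθ' : 4 * scalarL2Sq (θ₀s j) / ε ≤ T := hTθ
      rw [div_le_iff₀ hε] at hTθ'
      nlinarith [scalarL2Sq_nonneg (θ₀s j)]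
    have h2 : (8 * Real.pi ^ 2 * ν * ((K₀ : ℝ) + n) ^ 2 +
        8 * Real.pi * R * S.card * M / (∑ x ∈ Finset.range n, ((K₀ : ℝ) + R + x)⁻¹) + η₀ / 2) *
          timeMean (fun t => scalarL2Sq (θs j t)) T + η₀ / 2 ≤ 3 * ε / 8 :=
      le_trans (add_le_add (mul_le_mul_of_nonneg_left hVT hcoef0) le_rfl) hcoef
    linarith [hest, h1, h2]
  -- (6) but frequently it is ≥ 3ε/4
  have hfreq := frequently_le_timeMean_of_le_longTimeAvgSup hε (by positivity : (0 : ℝ) < ε / 4) (hfl j)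
  obtain ⟨T, hT1, hT2⟩ := (hfreq.and_eventually hev).exists
  linarith

/-- **REFUTED STRENGTHENING: no witness of the crux is stirred by a uniformly band-limited family of
flows** (Fourier support in a fixed box, amplitudes bounded uniformly in `j`). [folklore] -/
theorem not_cruxBandLimited (S : Finset ℤ²) (R : ℕ) (M : ℝ) (hS : ∀ k ∈ S, |k 0| ≤ R ∧ |k 1| ≤ R) (hM0 : 0 ≤ M) :
    ¬ ∃ (g : UnitAddTorus (Fin 2) → EuclideanSpace ℝ (Fin 2)) (h : UnitAddTorus (Fin 2) → ℝ), IsAdmissible g h ∧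
      ∃ (ν : ℕ → ℝ) (cs : ℕ → ℝ → ℤ² → EuclideanSpace ℂ (Fin 2))
        (v : ℕ → ℝ → UnitAddTorus (Fin 2) → EuclideanSpace ℝ (Fin 2))
        (θ₀ : ℕ → UnitAddTorus (Fin 2) → ℝ) (θ : ℕ → ℝ → UnitAddTorus (Fin 2) → ℝ),
        (∀ j, 0 < ν j) ∧ Tendsto ν atTop (nhds 0) ∧
        (∀ j k, Continuous fun s => cs j s k) ∧ (∀ j s k, ‖cs j s k‖ ≤ M) ∧
        (∀ j s, ∀ k ∈ S, zdot k (cs j s k) = 0) ∧ (∀ j s, v j s = realTrigPoly S (cs j s)) ∧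
        (∀ j, MemLp (θ₀ j) 2 volume) ∧
        (∀ j, IsWeakScalarTransportForced (ν j) (v j) (fun _ => h) (θ₀ j) (θ j)) ∧
        VarianceBounded θ ∧ Anomalous ν θ := by
  rintro ⟨g, h, hadm, ν, cs, v, θ₀, θ, hν, hν0, hc, hM, htrans, hu, hθ₀, hweak, ⟨E, hE⟩, hA⟩
  exact bandLimited_not_anomalous hadm.smooth_h hadm.zeroMean_h hS hM0 hν hν0 hc hM htrans hu hθ₀ hweak hE hA

/-- The same through the clause bundle of `Negative.KillShape`. [folklore] -/
theorem not_anomalous_of_isCandidate_bandLimited {S : Finset ℤ²} {R : ℕ} {M : ℝ}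
    (hS : ∀ k ∈ S, |k 0| ≤ R ∧ |k 1| ≤ R) (hM0 : 0 ≤ M)
    {g : UnitAddTorus (Fin 2) → EuclideanSpace ℝ (Fin 2)} {h : UnitAddTorus (Fin 2) → ℝ} (hadm : IsAdmissible g h)
    {ν : ℕ → ℝ} {v₀ : ℕ → UnitAddTorus (Fin 2) → EuclideanSpace ℝ (Fin 2)}
    {v : ℕ → ℝ → UnitAddTorus (Fin 2) → EuclideanSpace ℝ (Fin 2)}
    {cs : ℕ → ℝ → ℤ² → EuclideanSpace ℂ (Fin 2)} (hc : ∀ j k, Continuous fun s => cs j s k)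
    (hM : ∀ j s k, ‖cs j s k‖ ≤ M) (htrans : ∀ j s, ∀ k ∈ S, zdot k (cs j s k) = 0)
    (hu : ∀ j s, v j s = realTrigPoly S (cs j s))
    {θ₀ : ℕ → UnitAddTorus (Fin 2) → ℝ} {θ : ℕ → ℝ → UnitAddTorus (Fin 2) → ℝ}
    (hcand : IsCandidate g h ν v₀ v θ₀ θ) (hV : VarianceBounded θ) : ¬ Anomalous ν θ := by
  obtain ⟨E, hE⟩ := hV
  exact bandLimited_not_anomalous hadm.smooth_h hadm.zeroMean_h hS hM0 hcand.pos hcand.tendsto hc hM htrans hu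
    hcand.memLp hcand.weak hE

end CellNoGo

end Summit.AnomalousDissipation.AnomalousDissipation.Theorems.ScalarAnomalySteadySourceFormal.Negative
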